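import Mathlib
import HarnessLib
import Literature.Analysis.FluidPDE.SuitableWeak
import Literature.Analysis.FluidPDE.SelfSimilar
import Literature.Analysis.FluidPDE.LocalTypeI
import Literature.Analysis.FluidPDE.SpaceTimeRescaling
import Literature.Analysis.FluidPDE.LocalTypeIScaling
import Literature.Analysis.FluidPDE.LocalTypeICongr
import Literature.Analysis.FluidPDE.LocalTypeIReverseZoom
import Literature.Analysis.FluidPDE.SlabTypeICompactness
import Literature.Analysis.FluidPDE.TypeIRateOseenMildRepresentative
import Summits.NavierStokesRegularity.NavierStokesRegularity.Theorems.RellichScarApexLocalisationSpherePersistence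
import Summits.NavierStokesRegularity.NavierStokesRegularity.Theorems.RellichScarApexLocalisationClassBlowupPersistence
import Summits.NavierStokesRegularity.NavierStokesRegularity.Theorems.RellichScarApexLocalisationSmallRateRegularity
import Summits.NavierStokesRegularity.NavierStokesRegularity.Theorems.RellichScarApexLocalisationMovingCentrePersistence
import Summits.NavierStokesRegularity.NavierStokesRegularity.Theorems.RellichScarApexLocalisationRdSingularLump
import Summits.NavierStokesRegularity.NavierStokesRegularity.Theorems.RellichScarApexLocalisationRdSatelliteLump
import Summits.NavierStokesRegularity.NavierStokesRegularity.Theorems.RellichScarApexLocalisationRdLocalApex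
import Summits.NavierStokesRegularity.NavierStokesRegularity.Theorems.RellichScarApexLocalisationRdTower
import Summits.NavierStokesRegularity.NavierStokesRegularity.Theorems.RellichScarApexLocalisationRdCount
import Summits.NavierStokesRegularity.NavierStokesRegularity.Theorems.RellichScarApexLocalisationRdNormalise

/-!
# WEAK-`L³` TYPE-I PROFILES LOCALISE — the Russian-doll theorem (line russian-doll-multiplicity of
# crux `RellichScar.ApexLocalisation`, stmt-NavierStokesRegularity-11719; lead c5)

`stub_rdWeakL3Localisation` (the crux-ideate card's `WeakL3Localisation`, UNCONDITIONAL): if a suitable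
weak solution of Navier–Stokes on the backward slab `(-∞,0) × ℝ³` with Albritton–Barker quantity `𝐈 < ⊤`,
the Type-I RATE `‖u(t,x)‖ ≤ C/√(−t)`, a backward-singular space–time origin AND the uniform weak-`L³`
slice bound `h³ |{x : h < ‖u(t,x)‖}| ≤ M` (all `t < 0`, `h > 0`; the `L^∞_t L^{3,∞}_x` class of
Choe–Wolf–Yang 2019 / Barker 2022) exists, then an APEX-class singular profile exists: a suitable weak
slab solution with `𝐈 < ⊤`, the space–time bound `‖u(t,x)‖ ≤ C'/(‖x‖ + √(−t))` and a singular origin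
— the conclusion of `RellichScar.ApexLocalisation`.  Known finiteness theorems in this class
(Choe–Wolf–Yang, Barker: finitely many singular points at the blow-up time) do not give Type-I apex
structure; the doll argument does.

Proof = composition `rd_weakL3Localisation` of the six landed stubs of the line:

* S6a `stub_rdNormalise.1` — continuous (Oseen-mild) representative, slice bound for a.e. `t`;
* S1 `stub_rdSingularLump`, S2 `stub_rdSatelliteLump` — constants `η, μ, A`: a singular point, resp. a
  point with `‖w‖ ≥ A`, forces measure `≥ μ` of `{η/√(−t) < ‖w‖}` in the unit cylinder below it;
* pick `m` with `(m+1) μ η³ > M`;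
* S4 `stub_rdTower` (granted `¬` conclusion and S3 `stub_rdLocalApex`) — `m` blowing-up satellites
  `‖w(τᵢ,yᵢ)‖ > A/ρ`, pairwise and from the origin `3ρ`-separated, at one scale `ρ`;
* S6b `stub_rdNormalise.2` — rescale by `ρ`; S1/S2 give `m+1` lumps over `3`-separated unit balls;
* S5 `stub_rdCount` — Tonelli + the slice bound: `(m+1) μ η³ ≤ M`, contradiction.

## References

* D. Albritton, T. Barker, J. Math. Fluid Mech. 21 (2019) = arXiv:1811.00502, Lemma 2.2, Prop. 2.3, §3. [AlbrittonBarker2019]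
* H. J. Choe, J. Wolf, M. Yang, Math. Ann. (2020) = arXiv:1611.04725, Thm 2. [ChoeWolfYang2019]
* T. Barker, arXiv:2111.14776, Thm 2. [Barker2024]
-/

noncomputable section

set_option linter.dupNamespace false

namespace Summit.NavierStokesRegularity.NavierStokesRegularity.Theorems.RellichScarApexLocalisation

open MeasureTheory Set Function Metric Filter Topology TopologicalSpace
open scoped ENNReal NNReal
open Literature.Analysis Literature.Analysis.FluidPDE

local notation "E³" => EuclideanSpace ℝ (Fin 3)

/-- The open backward slab `(-∞, 0) × ℝ³` (time first). -/
local notation "𝕊" => Literature.Analysis.FluidPDE.slab (EuclideanSpace ℝ (Fin 3)) (Set.Iio (0 : ℝ)) isOpen_Iio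

/-- Values of a Navier–Stokes image `ρ w(ρ² t, ρ x)` at the preimage point. -/
theorem rd_image_apply (ρ : ℝ) (hρ : ρ ≠ 0) (w : ℝ → E³ → E³) (t : ℝ) (x : E³) :
    (ρ • stPull (ρ ^ 2) ρ 0 0 w) (t / ρ ^ 2) (ρ⁻¹ • x) = ρ • w t x := by
  rw [smul_stPull_apply]
  congr 2
  · field_simp
    ring
  · rw [smul_smul, mul_inv_cancel₀ hρ, one_smul, zero_add]

/-- Monotonicity of the lump sets in the threshold. -/
theorem rd_lump_mono {η η' : ℝ} (h : η ≤ η') (w : ℝ → E³ → E³) (z₀ : ℝ × E³) :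
    {z ∈ parabolicCylinder 1 z₀ | η' / Real.sqrt (-z.1) < ‖w z.1 z.2‖} ⊆
      {z ∈ parabolicCylinder 1 z₀ | η / Real.sqrt (-z.1) < ‖w z.1 z.2‖} := by
  rintro z ⟨hz, hlt⟩
  refine ⟨hz, lt_of_le_of_lt ?_ hlt⟩
  exact div_le_div_of_nonneg_right h (Real.sqrt_nonneg _)

/-- **WEAK-`L³` TYPE-I PROFILES LOCALISE** (the card's `WeakL3Localisation`, composition of S1–S6): a
rate-Type-I singular suitable weak slab profile with `𝐈 < ⊤` and the uniform weak-`L³` slice bound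
`h³ |{x : h < ‖u(t,x)‖}| ≤ M` yields an apex-class singular profile.  By contradiction: normalise to the
continuous representative (S6a); constants `η, μ` of S1/S2; pick `m` with `(m+1) μ η³ > M`; the tower
S4 with `ε = 1/A` gives `m` satellites at a scale `ρ`; rescale by `ρ` (S6b); the origin (S1) and the
`m` satellites (S2) give `m + 1` lumps over `3`-separated centres; S5 bounds `(m+1) μ η³ ≤ M`. -/
theorem rd_weakL3Localisation
    (h1 : ∀ (I : ℝ≥0∞), I < ⊤ → ∃ η : ℝ, 0 < η ∧ ∃ μ : ℝ, 0 < μ ∧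
      ∀ (w : ℝ → E³ → E³) (q : ℝ → E³ → ℝ) (H : ℝ → E³ → E³ →L[ℝ] E³),
        IsSuitableWeakSolutionOn 𝕊 1 0 w q → HasWeakSpatialGradientOn 𝕊 w H →
        typeIBound (Iio (0 : ℝ) ×ˢ univ) w q H ≤ I → IsBackwardSingularPoint w 0 →
        ENNReal.ofReal μ ≤
          volume {z ∈ parabolicCylinder 1 (0 : ℝ × E³) | η / Real.sqrt (-z.1) < ‖w z.1 z.2‖})
    (h2 : ∀ (C : ℝ) (I : ℝ≥0∞), I < ⊤ → ∃ A : ℝ, 0 < A ∧ ∃ η : ℝ, 0 < η ∧ ∃ μ : ℝ, 0 < μ ∧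
      ∀ (w : ℝ → E³ → E³) (q : ℝ → E³ → ℝ) (H : ℝ → E³ → E³ →L[ℝ] E³),
        IsSuitableWeakSolutionOn 𝕊 1 0 w q → HasWeakSpatialGradientOn 𝕊 w H →
        typeIBound (Iio (0 : ℝ) ×ˢ univ) w q H ≤ I → HasTypeITimeDecay C w →
        ContinuousOn (uncurry w) (Iio (0 : ℝ) ×ˢ univ) →
        ∀ (t : ℝ) (y : E³), t < 0 → A ≤ ‖w t y‖ →
        ENNReal.ofReal μ ≤
          volume {z ∈ parabolicCylinder 1 ((0 : ℝ), y) | η / Real.sqrt (-z.1) < ‖w z.1 z.2‖})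
    (h3 : ∀ (K r : ℝ) (I : ℝ≥0∞), I < ⊤ → 0 < r →
      ∀ (w : ℝ → E³ → E³) (q : ℝ → E³ → ℝ) (H : ℝ → E³ → E³ →L[ℝ] E³),
        IsSuitableWeakSolutionOn 𝕊 1 0 w q → HasWeakSpatialGradientOn 𝕊 w H →
        typeIBound (Iio (0 : ℝ) ×ˢ univ) w q H ≤ I → IsBackwardSingularPoint w 0 →
        (∀ (t : ℝ) (x : E³), -r ^ 2 < t → t < 0 → ‖x‖ < r → ‖w t x‖ ≤ K / (‖x‖ + Real.sqrt (-t))) →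
        ∃ (C' : ℝ) (u : ℝ → E³ → E³) (p : ℝ → E³ → ℝ) (G : ℝ → E³ → E³ →L[ℝ] E³),
          IsSuitableWeakSolutionOn 𝕊 1 0 u p ∧ HasWeakSpatialGradientOn 𝕊 u G ∧
          typeIBound (Iio (0 : ℝ) ×ˢ univ) u p G < ⊤ ∧ HasTypeIDecay C' u ∧
          IsBackwardSingularPoint u 0)
    (h4 : (¬ ∃ (C' : ℝ) (u : ℝ → E³ → E³) (p : ℝ → E³ → ℝ) (G : ℝ → E³ → E³ →L[ℝ] E³),
        IsSuitableWeakSolutionOn 𝕊 1 0 u p ∧ HasWeakSpatialGradientOn 𝕊 u G ∧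
        typeIBound (Iio (0 : ℝ) ×ˢ univ) u p G < ⊤ ∧ HasTypeIDecay C' u ∧
        IsBackwardSingularPoint u 0) →
    (∀ (K r : ℝ) (I : ℝ≥0∞), I < ⊤ → 0 < r →
      ∀ (w : ℝ → E³ → E³) (q : ℝ → E³ → ℝ) (H : ℝ → E³ → E³ →L[ℝ] E³),
        IsSuitableWeakSolutionOn 𝕊 1 0 w q → HasWeakSpatialGradientOn 𝕊 w H →
        typeIBound (Iio (0 : ℝ) ×ˢ univ) w q H ≤ I → IsBackwardSingularPoint w 0 →
        (∀ (t : ℝ) (x : E³), -r ^ 2 < t → t < 0 → ‖x‖ < r → ‖w t x‖ ≤ K / (‖x‖ + Real.sqrt (-t))) →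
        ∃ (C' : ℝ) (u : ℝ → E³ → E³) (p : ℝ → E³ → ℝ) (G : ℝ → E³ → E³ →L[ℝ] E³),
          IsSuitableWeakSolutionOn 𝕊 1 0 u p ∧ HasWeakSpatialGradientOn 𝕊 u G ∧
          typeIBound (Iio (0 : ℝ) ×ˢ univ) u p G < ⊤ ∧ HasTypeIDecay C' u ∧
          IsBackwardSingularPoint u 0) →
    ∀ (m : ℕ) (C : ℝ) (I : ℝ≥0∞), I < ⊤ →
      ∀ (w : ℝ → E³ → E³) (q : ℝ → E³ → ℝ) (H : ℝ → E³ → E³ →L[ℝ] E³),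
        IsSuitableWeakSolutionOn 𝕊 1 0 w q → HasWeakSpatialGradientOn 𝕊 w H →
        typeIBound (Iio (0 : ℝ) ×ˢ univ) w q H ≤ I → HasTypeITimeDecay C w →
        ContinuousOn (uncurry w) (Iio (0 : ℝ) ×ˢ univ) → IsBackwardSingularPoint w 0 →
        ∀ (ε δ : ℝ), 0 < ε → 0 < δ →
        ∃ ρ : ℝ, 0 < ρ ∧ ρ < δ ∧ ∃ (τ : Fin m → ℝ) (y : Fin m → E³),
          (∀ i, -(ε * ρ ^ 2) < τ i ∧ τ i < 0 ∧ ‖y i‖ < δ ∧ 3 * ρ < ‖y i‖ ∧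
            1 / (ε * ρ) < ‖w (τ i) (y i)‖) ∧
          (∀ i j, i ≠ j → 3 * ρ < ‖y i - y j‖))
    (h5 : ∀ (M η μ : ℝ) (n : ℕ) (w : ℝ → E³ → E³) (y : Fin n → E³),
      0 < η → 0 < μ → ContinuousOn (uncurry w) (Iio (0 : ℝ) ×ˢ univ) →
      (∀ᵐ t : ℝ, t < 0 → ∀ h : ℝ, 0 < h →
        ENNReal.ofReal (h ^ 3) * volume {x : E³ | h < ‖w t x‖} ≤ ENNReal.ofReal M) →
      (∀ i j, i ≠ j → 2 ≤ ‖y i - y j‖) →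
      (∀ i, ENNReal.ofReal μ ≤
        volume {z ∈ parabolicCylinder 1 ((0 : ℝ), y i) | η / Real.sqrt (-z.1) < ‖w z.1 z.2‖}) →
      ENNReal.ofReal ((n : ℝ) * μ * η ^ 3) ≤ ENNReal.ofReal M)
    (h6a : ∀ (C M : ℝ) (u : ℝ → E³ → E³) (p : ℝ → E³ → ℝ) (G : ℝ → E³ → E³ →L[ℝ] E³),
      IsSuitableWeakSolutionOn 𝕊 1 0 u p → HasWeakSpatialGradientOn 𝕊 u G →
      typeIBound (Iio (0 : ℝ) ×ˢ univ) u p G < ⊤ → HasTypeITimeDecay C u →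
      IsBackwardSingularPoint u 0 →
      (∀ t : ℝ, t < 0 → ∀ h : ℝ, 0 < h →
        ENNReal.ofReal (h ^ 3) * volume {x : E³ | h < ‖u t x‖} ≤ ENNReal.ofReal M) →
      ∃ v : ℝ → E³ → E³,
        IsSuitableWeakSolutionOn 𝕊 1 0 v p ∧ HasWeakSpatialGradientOn 𝕊 v G ∧
        typeIBound (Iio (0 : ℝ) ×ˢ univ) v p G < ⊤ ∧ HasTypeITimeDecay C v ∧
        ContinuousOn (uncurry v) (Iio (0 : ℝ) ×ˢ univ) ∧ IsBackwardSingularPoint v 0 ∧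
        (∀ᵐ t : ℝ, t < 0 → ∀ h : ℝ, 0 < h →
          ENNReal.ofReal (h ^ 3) * volume {x : E³ | h < ‖v t x‖} ≤ ENNReal.ofReal M))
    (h6b : ∀ (C M : ℝ) (I : ℝ≥0∞) (ρ : ℝ) (v : ℝ → E³ → E³) (q : ℝ → E³ → ℝ)
      (H : ℝ → E³ → E³ →L[ℝ] E³),
      0 < ρ → IsSuitableWeakSolutionOn 𝕊 1 0 v q → HasWeakSpatialGradientOn 𝕊 v H →
      typeIBound (Iio (0 : ℝ) ×ˢ univ) v q H ≤ I → HasTypeITimeDecay C v →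
      ContinuousOn (uncurry v) (Iio (0 : ℝ) ×ˢ univ) → IsBackwardSingularPoint v 0 →
      (∀ᵐ t : ℝ, t < 0 → ∀ h : ℝ, 0 < h →
        ENNReal.ofReal (h ^ 3) * volume {x : E³ | h < ‖v t x‖} ≤ ENNReal.ofReal M) →
      IsSuitableWeakSolutionOn 𝕊 1 0 (ρ • stPull (ρ ^ 2) ρ 0 0 v) (ρ ^ 2 • stPull (ρ ^ 2) ρ 0 0 q) ∧
      HasWeakSpatialGradientOn 𝕊 (ρ • stPull (ρ ^ 2) ρ 0 0 v) (ρ ^ 2 • stPull (ρ ^ 2) ρ 0 0 H) ∧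
      typeIBound (Iio (0 : ℝ) ×ˢ univ) (ρ • stPull (ρ ^ 2) ρ 0 0 v) (ρ ^ 2 • stPull (ρ ^ 2) ρ 0 0 q)
        (ρ ^ 2 • stPull (ρ ^ 2) ρ 0 0 H) ≤ I ∧
      HasTypeITimeDecay C (ρ • stPull (ρ ^ 2) ρ 0 0 v) ∧
      ContinuousOn (uncurry (ρ • stPull (ρ ^ 2) ρ 0 0 v)) (Iio (0 : ℝ) ×ˢ univ) ∧
      IsBackwardSingularPoint (ρ • stPull (ρ ^ 2) ρ 0 0 v) 0 ∧
      (∀ᵐ t : ℝ, t < 0 → ∀ h : ℝ, 0 < h →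
        ENNReal.ofReal (h ^ 3) * volume {x : E³ | h < ‖(ρ • stPull (ρ ^ 2) ρ 0 0 v) t x‖} ≤
          ENNReal.ofReal M)) :
    ∀ (C M : ℝ),
      (∃ (u : ℝ → E³ → E³) (p : ℝ → E³ → ℝ) (G : ℝ → E³ → E³ →L[ℝ] E³),
        IsSuitableWeakSolutionOn 𝕊 1 0 u p ∧ HasWeakSpatialGradientOn 𝕊 u G ∧
        typeIBound (Iio (0 : ℝ) ×ˢ univ) u p G < ⊤ ∧ HasTypeITimeDecay C u ∧
        IsBackwardSingularPoint u 0 ∧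
        ∀ t : ℝ, t < 0 → ∀ h : ℝ, 0 < h →
          ENNReal.ofReal (h ^ 3) * volume {x : E³ | h < ‖u t x‖} ≤ ENNReal.ofReal M) →
      ∃ (C' : ℝ) (u : ℝ → E³ → E³) (p : ℝ → E³ → ℝ) (G : ℝ → E³ → E³ →L[ℝ] E³),
        IsSuitableWeakSolutionOn 𝕊 1 0 u p ∧ HasWeakSpatialGradientOn 𝕊 u G ∧
        typeIBound (Iio (0 : ℝ) ×ˢ univ) u p G < ⊤ ∧ HasTypeIDecay C' u ∧
        IsBackwardSingularPoint u 0 := by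
  rintro C M ⟨u, p, G, hsw, hwg, hI, hC, hsing, hweak⟩
  by_contra hnot
  -- ## S6a: the continuous representative
  obtain ⟨v, hswv, hwgv, hIv, hCv, hcontv, hsingv, hweakv⟩ :=
    h6a C M u p G hsw hwg hI hC hsing hweak
  set I : ℝ≥0∞ := typeIBound (Iio (0 : ℝ) ×ˢ univ) v p G with hIdef
  have hIlt : I < ⊤ := hIv
  have hIle : typeIBound (Iio (0 : ℝ) ×ˢ univ) v p G ≤ I := le_rfl
  -- ## constants of S1 / S2
  obtain ⟨η₁, hη₁, μ₁, hμ₁, hQ⟩ := h1 I hIlt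
  obtain ⟨A, hA, η₂, hη₂, μ₂, hμ₂, hS⟩ := h2 C I hIlt
  set η : ℝ := min η₁ η₂ with hηdef
  set μ : ℝ := min μ₁ μ₂ with hμdef
  have hη : 0 < η := lt_min hη₁ hη₂
  have hμ : 0 < μ := lt_min hμ₁ hμ₂
  have hημ : 0 < μ * η ^ 3 := by positivity
  -- ## the number of dolls
  obtain ⟨m, hm⟩ := exists_nat_gt (M / (μ * η ^ 3))
  have hmM : M < ((m + 1 : ℕ) : ℝ) * μ * η ^ 3 := by
    have h1' : M / (μ * η ^ 3) * (μ * η ^ 3) = M := div_mul_cancel₀ M hημ.ne'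
    have h2' : (m : ℝ) * (μ * η ^ 3) > M / (μ * η ^ 3) * (μ * η ^ 3) :=
      mul_lt_mul_of_pos_right hm hημ
    push_cast
    nlinarith
  -- ## S4: the tower with `ε = 1/A`, `δ = 1`
  have hε : 0 < 1 / A := by positivity
  obtain ⟨ρ, hρ, -, τ, y, hsat, hsep⟩ :=
    h4 hnot h3 m C I hIlt v p G hswv hwgv hIle hCv hcontv hsingv (1 / A) 1 hε one_pos
  -- ## S6b: rescale by `ρ`
  set vt : ℝ → E³ → E³ := ρ • stPull (ρ ^ 2) ρ 0 0 v with hvt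
  obtain ⟨hsw', hwg', hIle', hC', hcont', hsing', hweak'⟩ :=
    h6b C M I ρ v p G hρ hswv hwgv hIle hCv hcontv hsingv hweakv
  -- ## the `m + 1` centres: the origin and the rescaled satellites
  set c : Fin (m + 1) → E³ := Fin.cons (0 : E³) (fun i => ρ⁻¹ • y i) with hc
  have hc0 : c 0 = 0 := by simp [hc]
  have hcs : ∀ i : Fin m, c i.succ = ρ⁻¹ • y i := fun i => by simp [hc]
  have hnorm_smul : ∀ x : E³, ‖ρ⁻¹ • x‖ = ρ⁻¹ * ‖x‖ := fun x => by
    rw [norm_smul, Real.norm_of_nonneg (inv_nonneg.2 hρ.le)]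
  have h3ρ : ∀ x : E³, 3 * ρ < ‖x‖ → 2 ≤ ‖ρ⁻¹ • x‖ := fun x hx => by
    rw [hnorm_smul, le_inv_mul_iff₀ hρ]
    linarith
  have hsep' : ∀ i j : Fin (m + 1), i ≠ j → 2 ≤ ‖c i - c j‖ := by
    intro i j hij
    induction i using Fin.cases with
    | zero =>
      induction j using Fin.cases with
      | zero => exact absurd rfl hij
      | succ j =>
        rw [hc0, hcs, zero_sub, norm_neg]
        exact h3ρ _ (hsat j).2.2.2.1
    | succ i =>
      induction j using Fin.cases with
      | zero =>
        rw [hc0, hcs, sub_zero]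
        exact h3ρ _ (hsat i).2.2.2.1
      | succ j =>
        rw [hcs, hcs, ← smul_sub]
        exact h3ρ _ (hsep i j fun h => hij (by rw [h]))
  -- ## the lumps: the origin (S1) and the satellites (S2)
  have hlump : ∀ i : Fin (m + 1), ENNReal.ofReal μ ≤
      volume {z ∈ parabolicCylinder 1 ((0 : ℝ), c i) | η / Real.sqrt (-z.1) < ‖vt z.1 z.2‖} := by
    intro i
    induction i using Fin.cases with
    | zero =>
      rw [hc0]
      calc ENNReal.ofReal μ ≤ ENNReal.ofReal μ₁ := ENNReal.ofReal_le_ofReal (min_le_left _ _)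
        _ ≤ volume {z ∈ parabolicCylinder 1 (0 : ℝ × E³) | η₁ / Real.sqrt (-z.1) < ‖vt z.1 z.2‖} :=
            hQ vt _ _ hsw' hwg' hIle' hsing'
        _ ≤ _ := measure_mono (rd_lump_mono (min_le_left _ _) vt _)
    | succ i =>
      rw [hcs]
      obtain ⟨hτ1, hτ2, -, -, hbig⟩ := hsat i
      have hval : A ≤ ‖vt (τ i / ρ ^ 2) (ρ⁻¹ • y i)‖ := by
        rw [hvt, rd_image_apply ρ hρ.ne' v, norm_smul, Real.norm_of_nonneg hρ.le]
        rw [div_lt_iff₀ (by positivity)] at hbig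
        have h := mul_lt_mul_of_pos_left hbig hA
        have e : A * (‖v (τ i) (y i)‖ * (1 / A * ρ)) = ρ * ‖v (τ i) (y i)‖ := by
          field_simp
        rw [e, mul_one] at h
        exact h.le
      have hτ' : τ i / ρ ^ 2 < 0 := div_neg_of_neg_of_pos hτ2 (by positivity)
      calc ENNReal.ofReal μ ≤ ENNReal.ofReal μ₂ := ENNReal.ofReal_le_ofReal (min_le_right _ _)
        _ ≤ volume {z ∈ parabolicCylinder 1 ((0 : ℝ), ρ⁻¹ • y i) |
              η₂ / Real.sqrt (-z.1) < ‖vt z.1 z.2‖} :=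
            hS vt _ _ hsw' hwg' hIle' hC' hcont' _ _ hτ' hval
        _ ≤ _ := measure_mono (rd_lump_mono (min_le_right _ _) vt _)
  -- ## S5: count, and contradiction
  have hcount := h5 M η μ (m + 1) vt c hη hμ hcont' hweak' hsep' hlump
  have hpos : 0 < ((m + 1 : ℕ) : ℝ) * μ * η ^ 3 := by positivity
  exact absurd hcount (not_le.2 ((ENNReal.ofReal_lt_ofReal_iff hpos).2 hmM))

/-- **WEAK-`L³` TYPE-I PROFILES LOCALISE (the Russian-doll theorem; registered stub
`stub_rdWeakL3Localisation` of crux stmt-NavierStokesRegularity-11719).** A rate-Type-I singular suitable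
weak slab profile with `𝐈 < ⊤` and the uniform weak-`L³` slice bound `h³ |{x : h < ‖u(t,x)‖}| ≤ M`
yields an apex-class singular profile (the conclusion of `RellichScar.ApexLocalisation`): the composition
`rd_weakL3Localisation` of the landed stubs S1 `stub_rdSingularLump`, S2 `stub_rdSatelliteLump`,
S3 `stub_rdLocalApex`, S4 `stub_rdTower`, S5 `stub_rdCount`, S6 `stub_rdNormalise`.
[cite: AlbrittonBarker2019, Lemma 2.2, Prop. 2.3 and §3] -/
theorem stub_rdWeakL3Localisation :
    ∀ (C M : ℝ),
      (∃ (u : ℝ → E³ → E³) (p : ℝ → E³ → ℝ) (G : ℝ → E³ → E³ →L[ℝ] E³),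
        IsSuitableWeakSolutionOn 𝕊 1 0 u p ∧ HasWeakSpatialGradientOn 𝕊 u G ∧
        typeIBound (Iio (0 : ℝ) ×ˢ univ) u p G < ⊤ ∧ HasTypeITimeDecay C u ∧
        IsBackwardSingularPoint u 0 ∧
        ∀ t : ℝ, t < 0 → ∀ h : ℝ, 0 < h →
          ENNReal.ofReal (h ^ 3) * volume {x : E³ | h < ‖u t x‖} ≤ ENNReal.ofReal M) →
      ∃ (C' : ℝ) (u : ℝ → E³ → E³) (p : ℝ → E³ → ℝ) (G : ℝ → E³ → E³ →L[ℝ] E³),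
        IsSuitableWeakSolutionOn 𝕊 1 0 u p ∧ HasWeakSpatialGradientOn 𝕊 u G ∧
        typeIBound (Iio (0 : ℝ) ×ˢ univ) u p G < ⊤ ∧ HasTypeIDecay C' u ∧
        IsBackwardSingularPoint u 0 :=
  rd_weakL3Localisation stub_rdSingularLump (stub_rdSatelliteLump stub_rdSingularLump) stub_rdLocalApex
    stub_rdTower stub_rdCount stub_rdNormalise.1 stub_rdNormalise.2

end Summit.NavierStokesRegularity.NavierStokesRegularity.Theorems.RellichScarApexLocalisation

end
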